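import Summits.QuantumFields.YangMills.Theorems.BalabanUVNodesN07Lemma1BlockPairAllBonds
import Summits.QuantumFields.YangMills.Theorems.BalabanUVNodesN07Lemma1CrossingBondsAtRecord
import Literature.MathematicalPhysics.QuantumFieldTheory.Balaban1983to89.B15Claim189UnitTestAtRecord
import Literature.MathematicalPhysics.QuantumFieldTheory.BalabanImbrieJaffe1984to88.BIJ85Eq219Proof
import Literature.MathematicalPhysics.QuantumFieldTheory.Balaban1983to89.T4SmallFieldWindowSandwich
import HarnessLib

/-!
# DAG node N07 [B11] — (155) DOWN THE TOWER: the per-level data letters `v_j`, `j ≤ k`, of ONE representative `U′` from the TOP letter `v_k`, the per-level (7)-smallness of the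
# representative's own averages and the per-level WITHIN-BLOCK letters `τ_j`, by downward induction over nested per-level windows — n07-w5's Lemma 1 of [6] (1.25)
# (`dist1_crossingBond_le_at_record`, generic in the level-`j` field) run once per level on `W := M^j(U′)`, whose next average IS `M^{j+1}(U′)` by `rfl`

Cell `pub-ymgap` (HUMAN RULINGS D-0062 ∕ D-0088 ∕ D-0149), width seat `pub-ymgap-dag-n07-w6` (second wave), harness re-seat g0″, 2026-08-28; CLAIM-5 of this generation (own lineage: the (r4)-rec rows
p613291∕p615982∕p625700∕p626639 display `v`; n07-w8 g4's (r2) door p625131∕p627069 asks `v_j` PER LEVEL; this file is the bookkeeping that produces every `v_j` from displayed one-level letters).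
`--kind proof --supports stmt-QuantumFields-27364 --as helper` (K1⁹ per dag-lead KEY MAP v2; count-neutral).  THEOREMS ONLY.  Contour-agnostic: the representative `U′` is any configuration —
on an axial tower (either contour system) the within-block letters `τ_j` are the tree-gauge counts of the data lane (n07-w5), DISPLAYED here.

THE PRINT.  [B11] = [Balaban1985Variational] p. 302 (155) «|V″(b) − 1| < 18d²L³Mε₀ for b ∈ 𝔅_j … and we have used the axial gauge conditions»; (7) p. 279; [6] = [Balaban1985RegularSpaces]
Lemma 1 (1.23)–(1.25) p. 79 («|V′(b) − 1| < 4d²α₀ + α₁» for the bonds joining neighbouring blocks); [I] = [Balaban1987RG1] (0.3)–(0.4) p. 252–253.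

WHAT THIS FILE DOES (lattice bookkeeping + by-name composition; NOTHING of [B11]∕[6] analysis asserted).
* §1 GEOMETRY OF A FINE BOND AGAINST THE BLOCKS (generic `P`; «block kept or moved by the unit step» is lit-balaban's `BIJ85Eq219Proof.blockOf_tgt`, cited not restated):
  ★ `exists_coarse_of_crossing` — a level-`j` bond `b` whose ends lie in DIFFERENT blocks is a far-face crossing bond of the `(j+1)`-bond `c := ⟨blockOf b₋, dir b⟩`: `c₊ = blockOf b₊` and
  `b = ⟨blockSite c₋ r, dir c⟩` with `r_{dir c} = L − 1` (n07-w5's `exists_offset_of_crossing`).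
* §2 ONE LEVEL (generic `SU(N)` torus of the family, level `j + 1 ≤ m + K`, any `U′`): ★★ `dist1_iter_le_of_succ` — if (i) the level-`j` plaquettes of `M^j U′` based in the three blocks around every
  `(j+1)`-bond of the window `W′` are `< a` with `t := ((d+2)L)²∕4·a < δ_N`, (ii) `dist1 (M^{j+1}U′(c)) ≤ α` for the `(j+1)`-bonds `c` with both ends in `W′`, (iii) the within-block letter
  `dist1 (M^j U′ b) ≤ τ` for fine bonds inside a block of `W′`, then EVERY level-`j` bond whose two ends have their blocks in `W′` obeys `dist1 (M^j U′ b) ≤ max τ (α + 7t + (d+1)(L−1)τ)` —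
  within a block by (iii), across by n07-w5's `dist1_crossingBond_le_at_record` at `W := M^j U′` (`M^{j+1}U′ = (avOfRecord j).avg (M^j U′)` by `rfl`) through §1.
* §3 ★★★ `dist1_iter_le_down_the_tower` — THE INDUCTION: per-level windows `W j ⊆ T^{(j)}` NESTED UNDER BLOCKING (`x ∈ W j ⇒ blockOf x ∈ W (j+1)` for `j < k`), per-level letters `a_j`, `τ_j`
  with (i)–(iii) at every `j < k`, a TOP letter `dist1 (M^k U′ c) ≤ v_k` on the bonds of `W k`, and any ladder `v` with `max τ_j (v_{j+1} + 7t_j + (d+1)(L−1)τ_j) ≤ v_j` ⇒ for EVERY `j ≤ k`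
  and every level-`j` bond with both ends in `W j`: `dist1 (M^j U′ c) ≤ v_j` — print's (155) as a recursion the knit evaluates (e.g. at the record's `9dL²Mε₀`-type letters).
  `dist1_iter_le_down_the_tower_box` — the same with the windows given as covered boxes `castSite '' [lo j, hi j]` (the shape of this base's rows and of n07-w8's per-level corners).
* §4 (A6) NON-VACUITY: `plaq_down_the_tower_one` — the plaquette hypothesis holds at `U′ = 1` for every `a > 0` (pv26 `plaqSmallOn_one`); the within-block ∕ top ∕ conclusion letters hold
  there with `τ_j := 0`, `v := 0` by this base's p613938 `N07ShearSizeTopBox.dist1_iter_avOfRecord_one` (cited, not restated) — the binder block of §3 is inhabited on every family of windows.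

HONEST FRAMING (binding).  Count-neutral helper; by-name composition of LANDED theorems (dag-n07-w5 p612161-lineage `…Lemma1CrossingBondsAtRecord` ∕ `…Lemma1CrossingBonds` ∕ `…BlockPairAllBonds`,
lit-balaban `BIJ85Eq219Proof.blockOf_tgt`, node00-def `avOfRecord`); the per-level (7)-smallness of the representative's averages, the within-block letters `τ_j` (the data lane's tree-gauge counts on an axial
tower), the top letter `v_k` ((147)∕(160)-I, module 40) and the window nesting are HYPOTHESES; nothing of [B11]∕[6] analysis asserted; the ladder `v` is evaluated by the consumer; `stub_prop8StepCoP13` ∕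
K0⁷ ∕ K1⁹ NOT closed; N07 NOT discharged; the chair's tally of record is the only count; **no summit statement is proved by this seat** — one finite `T⁴` programme at fixed `ε`, Bałaban AS PRINTED;
the route closes the conditional finite-𝕋⁴ rung `BalabanLadder.UV` only; NOT continuum ∕ ℝ⁴ ∕ OS ∕ mass gap ∕ Clay.  No `sorry`, no `def`, no `instance`, no `notation`.
-/

noncomputable section

namespace Summit.QuantumFields.YangMills.BalabanUVNodes.N07DataDownTheTower

open scoped Matrix.Norms.L2Operator
open Literature.MathematicalPhysics.QuantumFieldTheory.Balaban1983to89
open Literature.MathematicalPhysics.QuantumFieldTheory.Balaban1983to89.Node00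
open T4Continuum
open T4AxialGaugeSmallField (castSite)
open ExpMeanLog (deltaSU)
open Summit.QuantumFields.YangMills.BalabanUVNodes.N07Lemma1BlockPairAllBonds (dir_eq_of_blockOf_crossing)
open Summit.QuantumFields.YangMills.BalabanUVNodes.N07Lemma1CrossingBonds (exists_offset_of_crossing)
open Summit.QuantumFields.YangMills.BalabanUVNodes.N07Lemma1CrossingBondsAtRecord (dist1_crossingBond_le_at_record)

/-! ## §1  A fine bond against the blocks: within one block, or a far-face crossing bond of a coarse bond -/

section Geometry

variable {P : Params} {j : ℕ}

/-- ★ **A FINE BOND ACROSS TWO BLOCKS IS A FAR-FACE CROSSING BOND OF THE COARSE BOND JOINING THEM**: if `blockOf b₊ ≠ blockOf b₋` then, with `c := ⟨blockOf b₋, dir b⟩ ∈ T^{(j+1)}`, `c₊ = blockOf b₊`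
and `b = ⟨blockSite c₋ r, dir c⟩` for an offset `r` with `r_{dir c} = L − 1` ([6] (1.23)'s «bonds joining neighbouring blocks»; n07-w5's `exists_offset_of_crossing`).
[cite: Balaban1985RegularSpaces, (1.23) p.79; Balaban1987RG1, (0.3) p.252] -/
theorem exists_coarse_of_crossing (hj : j + 1 ≤ P.m + P.K) (b : PBond P j) (hb : blockOf b.tgt ≠ blockOf b.src) :
    (⟨blockOf b.src, b.dir⟩ : PBond P (j + 1)).tgt = blockOf b.tgt ∧
      ∃ r : Fin P.d → Fin P.L, (r b.dir : ℕ) = P.L - 1 ∧ b = ⟨Site.blockSite (blockOf b.src) r, b.dir⟩ := by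
  have htgt : blockOf b.tgt = (blockOf b.src).shift b.dir := (Literature.MathematicalPhysics.QuantumFieldTheory.BalabanImbrieJaffe1984to88.BIJ85Eq219Proof.blockOf_tgt hj b).resolve_left hb
  refine ⟨htgt.symm, ?_⟩
  have hne : blockOf b.tgt ≠ (⟨blockOf b.src, b.dir⟩ : PBond P (j + 1)).src := hb
  obtain ⟨r, hr, hbr⟩ := exists_offset_of_crossing hj ⟨blockOf b.src, b.dir⟩ b rfl rfl hne
  exact ⟨r, hr, hbr⟩

end Geometry

/-! ## §2  One level: every fine bond of the window from the next level's letter, the plaquettes and the within-block letter -/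

section OneLevel

variable {F : T4Continuum.T4Family} {N : ℕ} [NeZero N] {K j : ℕ}

/-- ★★ **ONE LEVEL OF (155)** at `W := M^j(U′)` for ANY `U′`, `j + 1 ≤ m + K`, and a window `W′ ⊆ T^{(j+1)}`: (i) plaquettes of `M^j U′` in the three blocks around every `(j+1)`-bond of `W′`
are `< a`, `t := ((d+2)L)²∕4·a < δ_N`; (ii) `dist1 (M^{j+1}U′(c)) ≤ α` on the `(j+1)`-bonds of `W′`; (iii) `dist1 (M^j U′ b) ≤ τ` for fine bonds inside a block of `W′`.  Then every fine bond
whose ends have their blocks in `W′` has `dist1 (M^j U′ b) ≤ max τ (α + 7t + (d+1)(L−1)τ)` — within by (iii), across by n07-w5's Lemma 1 at `M^j U′` through §1.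
[cite: Balaban1985RegularSpaces, Lemma 1 (1.25) p.79; Balaban1985Variational, (155) p.302] -/
theorem dist1_iter_le_of_succ (hj : j + 1 ≤ (F.P K).m + (F.P K).K) (U' : GaugeField (F.P K) 0 (SU N)) (W' : Set (Site (F.P K) (j + 1))) {a α τ : ℝ}
    (ha : 0 ≤ a) (hτ : 0 ≤ τ) (ht : (((((F.P K).d + 2) * (F.P K).L : ℕ) : ℝ) ^ 2 / 4) * a < deltaSU (Fin N))
    (hplaq : ∀ c : PBond (F.P K) (j + 1), c.src ∈ W' → c.tgt ∈ W' → ∀ q : Plaq (F.P K) j,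
      (blockOf q.src = c.src.unshift c.dir ∨ blockOf q.src = c.src ∨ blockOf q.src = c.tgt) → dist1 (GaugeField.plaqHol (Averaging.iter (avOfRecord F N K) j U') q) < a)
    (hα : ∀ c : PBond (F.P K) (j + 1), c.src ∈ W' → c.tgt ∈ W' → dist1 (Averaging.iter (avOfRecord F N K) (j + 1) U' c) ≤ α)
    (hint : ∀ b : PBond (F.P K) j, blockOf b.src = blockOf b.tgt → blockOf b.src ∈ W' → dist1 (Averaging.iter (avOfRecord F N K) j U' b) ≤ τ)
    (b : PBond (F.P K) j) (hs : blockOf b.src ∈ W') (htg : blockOf b.tgt ∈ W') :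
    dist1 (Averaging.iter (avOfRecord F N K) j U' b) ≤
      max τ (α + 7 * ((((((F.P K).d + 2) * (F.P K).L : ℕ) : ℝ) ^ 2 / 4) * a) + ((((F.P K).d + 1) * ((F.P K).L - 1) : ℕ) : ℝ) * τ) := by
  by_cases hwithin : blockOf b.tgt = blockOf b.src
  · exact (hint b hwithin.symm hs).trans (le_max_left _ _)
  · -- across: `b` is a far-face crossing bond of `c := ⟨blockOf b₋, dir b⟩`, both ends of `c` in `W′`
    obtain ⟨hct, r, hr, hbr⟩ := exists_coarse_of_crossing hj b hwithin
    set c : PBond (F.P K) (j + 1) := ⟨blockOf b.src, b.dir⟩ with hc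
    have hcs : c.src ∈ W' := hs
    have hctg : c.tgt ∈ W' := by rw [hct]; exact htg
    have hmain := dist1_crossingBond_le_at_record (F := F) (N := N) hj ha hτ c (hplaq c hcs hctg) ht (hα c hcs hctg)
      (fun b' hb' hbc => hint b' hb' (by rcases hbc with h | h <;> [exact h ▸ hcs; exact h ▸ hctg])) r hr (Equiv.refl _) (Equiv.refl _)
    refine le_trans ?_ (le_max_right _ _)
    have hb' : b = ⟨Site.blockSite c.src r, c.dir⟩ := hbr
    rw [hb']
    exact hmain

end OneLevel

/-! ## §3  The induction down the tower -/

section Induction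

variable {F : T4Continuum.T4Family} {N : ℕ} [NeZero N] {K : ℕ}

/-- ★★★ **(155) DOWN THE TOWER.**  Representative `U′` (any configuration), height `k ≤ m + K`, per-level windows `W j ⊆ T^{(j)}` nested under blocking (`x ∈ W j ⇒ blockOf x ∈ W (j+1)`, `j < k`),
per-level letters `a_j, τ_j ≥ 0` with `t_j := ((d+2)L)²∕4·a_j < δ_N`, the level-`j` plaquettes of `M^j U′` around the `(j+1)`-bonds of `W (j+1)` `< a_j`, the within-block letters
`dist1 (M^j U′ b) ≤ τ_j` inside the blocks of `W (j+1)`, the TOP letter `dist1 (M^k U′ c) ≤ v_k` on the bonds of `W k`, and a ladder `v` with `max τ_j (v_{j+1} + 7t_j + (d+1)(L−1)τ_j) ≤ v_j` for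
`j < k`.  Then for every `j ≤ k` and every level-`j` bond `c` with both ends in `W j`: `dist1 (M^j U′ c) ≤ v_j`. [cite: Balaban1985Variational, (155) p.302; Balaban1985RegularSpaces, Lemma 1 (1.25) p.79] -/
theorem dist1_iter_le_down_the_tower {k : ℕ} (hk : k ≤ (F.P K).m + (F.P K).K) (U' : GaugeField (F.P K) 0 (SU N)) (W : ∀ j : ℕ, Set (Site (F.P K) j))
    (hnest : ∀ j < k, ∀ x : Site (F.P K) j, x ∈ W j → blockOf x ∈ W (j + 1))
    (a τ v : ℕ → ℝ) (ha : ∀ j < k, 0 ≤ a j) (hτ : ∀ j < k, 0 ≤ τ j)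
    (ht : ∀ j < k, (((((F.P K).d + 2) * (F.P K).L : ℕ) : ℝ) ^ 2 / 4) * a j < deltaSU (Fin N))
    (hplaq : ∀ j < k, ∀ c : PBond (F.P K) (j + 1), c.src ∈ W (j + 1) → c.tgt ∈ W (j + 1) → ∀ q : Plaq (F.P K) j,
      (blockOf q.src = c.src.unshift c.dir ∨ blockOf q.src = c.src ∨ blockOf q.src = c.tgt) → dist1 (GaugeField.plaqHol (Averaging.iter (avOfRecord F N K) j U') q) < a j)
    (hint : ∀ j < k, ∀ b : PBond (F.P K) j, blockOf b.src = blockOf b.tgt → blockOf b.src ∈ W (j + 1) → dist1 (Averaging.iter (avOfRecord F N K) j U' b) ≤ τ j)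
    (htop : ∀ c : PBond (F.P K) k, c.src ∈ W k → c.tgt ∈ W k → dist1 (Averaging.iter (avOfRecord F N K) k U' c) ≤ v k)
    (hv : ∀ j < k, max (τ j) (v (j + 1) + 7 * ((((((F.P K).d + 2) * (F.P K).L : ℕ) : ℝ) ^ 2 / 4) * a j) + ((((F.P K).d + 1) * ((F.P K).L - 1) : ℕ) : ℝ) * τ j) ≤ v j) :
    ∀ j ≤ k, ∀ c : PBond (F.P K) j, c.src ∈ W j → c.tgt ∈ W j → dist1 (Averaging.iter (avOfRecord F N K) j U' c) ≤ v j := by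
  -- downward induction on `n := k − j`
  suffices h : ∀ n j : ℕ, j + n = k → ∀ c : PBond (F.P K) j, c.src ∈ W j → c.tgt ∈ W j → dist1 (Averaging.iter (avOfRecord F N K) j U' c) ≤ v j by
    intro j hj c hs htg
    exact h (k - j) j (by omega) c hs htg
  intro n
  induction n with
  | zero => intro j hjk c hs htg; rw [Nat.add_zero] at hjk; subst hjk; exact htop c hs htg
  | succ n ih =>
      intro j hjk c hs htg
      have hjlt : j < k := by omega
      have hj1 : j + 1 ≤ (F.P K).m + (F.P K).K := by omega
      have hstep := dist1_iter_le_of_succ hj1 U' (W (j + 1)) (ha j hjlt) (hτ j hjlt) (ht j hjlt) (hplaq j hjlt)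
        (fun c' hs' htg' => ih (j + 1) (by omega) c' hs' htg') (hint j hjlt) c (hnest j hjlt _ hs) (hnest j hjlt _ htg)
      exact hstep.trans (hv j hjlt)

/-- **The same with covered boxes as windows** (`W j := castSite '' [lo j, hi j]`, the shape of this base's rows and of n07-w8's per-level corners): nesting reads
`x ∈ castSite '' [lo j, hi j] ⇒ blockOf x ∈ castSite '' [lo (j+1), hi (j+1)]`. [cite: Balaban1985Variational, (144) p.300, (155) p.302] -/
theorem dist1_iter_le_down_the_tower_box {k : ℕ} (hk : k ≤ (F.P K).m + (F.P K).K) (U' : GaugeField (F.P K) 0 (SU N)) (lo hi : ∀ j : ℕ, Fin (F.P K).d → ℤ)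
    (hnest : ∀ j < k, ∀ x : Site (F.P K) j, x ∈ (castSite '' Set.Icc (lo j) (hi j) : Set (Site (F.P K) j)) →
      blockOf x ∈ (castSite '' Set.Icc (lo (j + 1)) (hi (j + 1)) : Set (Site (F.P K) (j + 1))))
    (a τ v : ℕ → ℝ) (ha : ∀ j < k, 0 ≤ a j) (hτ : ∀ j < k, 0 ≤ τ j)
    (ht : ∀ j < k, (((((F.P K).d + 2) * (F.P K).L : ℕ) : ℝ) ^ 2 / 4) * a j < deltaSU (Fin N))
    (hplaq : ∀ j < k, ∀ c : PBond (F.P K) (j + 1), c.src ∈ (castSite '' Set.Icc (lo (j + 1)) (hi (j + 1)) : Set (Site (F.P K) (j + 1))) →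
      c.tgt ∈ (castSite '' Set.Icc (lo (j + 1)) (hi (j + 1)) : Set (Site (F.P K) (j + 1))) → ∀ q : Plaq (F.P K) j,
      (blockOf q.src = c.src.unshift c.dir ∨ blockOf q.src = c.src ∨ blockOf q.src = c.tgt) → dist1 (GaugeField.plaqHol (Averaging.iter (avOfRecord F N K) j U') q) < a j)
    (hint : ∀ j < k, ∀ b : PBond (F.P K) j, blockOf b.src = blockOf b.tgt →
      blockOf b.src ∈ (castSite '' Set.Icc (lo (j + 1)) (hi (j + 1)) : Set (Site (F.P K) (j + 1))) → dist1 (Averaging.iter (avOfRecord F N K) j U' b) ≤ τ j)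
    (htop : ∀ c : PBond (F.P K) k, c.src ∈ (castSite '' Set.Icc (lo k) (hi k) : Set (Site (F.P K) k)) → c.tgt ∈ (castSite '' Set.Icc (lo k) (hi k) : Set (Site (F.P K) k)) →
      dist1 (Averaging.iter (avOfRecord F N K) k U' c) ≤ v k)
    (hv : ∀ j < k, max (τ j) (v (j + 1) + 7 * ((((((F.P K).d + 2) * (F.P K).L : ℕ) : ℝ) ^ 2 / 4) * a j) + ((((F.P K).d + 1) * ((F.P K).L - 1) : ℕ) : ℝ) * τ j) ≤ v j) :
    ∀ j ≤ k, ∀ c : PBond (F.P K) j, c.src ∈ (castSite '' Set.Icc (lo j) (hi j) : Set (Site (F.P K) j)) → c.tgt ∈ (castSite '' Set.Icc (lo j) (hi j) : Set (Site (F.P K) j)) →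
      dist1 (Averaging.iter (avOfRecord F N K) j U' c) ≤ v j :=
  dist1_iter_le_down_the_tower hk U' (fun j => (castSite '' Set.Icc (lo j) (hi j) : Set (Site (F.P K) j))) hnest a τ v ha hτ ht hplaq hint htop hv

end Induction

/-! ## §4  (A6) Non-vacuity at the unit configuration -/

section NonVacuity

variable (F : T4Continuum.T4Family) (N : ℕ) [NeZero N]

/-- **A6**: at `U′ = 1` the conclusion of §3 holds with the zero ladder on EVERY window (this base's p613938 `N07ShearSizeTopBox.dist1_iter_avOfRecord_one`, not restated), the within-block ∕ top
hypotheses hold with `τ_j = 0`, `v_k = 0` by the same lemma, and the plaquette hypothesis at `U′ = 1` holds for every `a > 0`: every level-`j` plaquette of `M^j(1) = 1` is within any `a > 0` of `1`. [cite: Balaban1985Variational, (7) p.279 (bookkeeping)] -/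
theorem plaq_down_the_tower_one (K j : ℕ) {a : ℝ} (ha : 0 < a) (q : Plaq (F.P K) j) :
    dist1 (GaugeField.plaqHol (Averaging.iter (avOfRecord F N K) j (1 : GaugeField (F.P K) 0 (SU N))) q) < a := by
  rw [B15Claim189UnitTestAtRecord.iter_avOfRecord_one F N K j]
  exact T4SmallFieldWindowSandwich.plaqSmallOn_one (Set.univ : Set (Plaq (F.P K) j)) ha q (Set.mem_univ q)

end NonVacuity

end Summit.QuantumFields.YangMills.BalabanUVNodes.N07DataDownTheTower
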